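import Literature.Probability.Percolation.TriLowestCrossingPairs
import HarnessLib

/-!
# Two obstructions for arms around a term of the exploration sequence

Topic `Literature/Probability/Percolation`; family `crit-perc` / near-critical percolation on `𝕋`.
Bricks of the near-critical arm-separation theorem for four arms in the ADJACENT colour
arrangement (P. Nolin, EJP 13 (2008), Thm. 11, `j = 4`, `σ = BBWW` [arXiv 0711.4948: Thm. 10];
the last missing input `hsepAdj` of `Werner2009_lemma63_of_altSeparation_of_adjSeparation`).

For two arms of the SAME colour the rerouting of Nolin 2008, §4.4 (proof of Lemma 15, last
paragraph) is organised (in the tree) through Menger's theorem (`exists_two_disjoint_paths`):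
it suffices that no single open site cuts both arms from all the fences. The configurations in
which a site would be such a cut are excluded by two planar obstructions about a term
`c = c_u` of the exploration sequence and an open crossing `α` of the same stage meeting it:

* `JDomain.disjoint_of_stage_crossing` — (**no low bypass**) an open crossing `K` of stage `u`
  (above the term `u - 1`), with ANY tip lower than the tip of `α` and disjoint from `α`, forces
  `α ∩ c = ∅` (generalises `disjoint_of_stage_crossing_same_tip`, whose tip was that of `c`);
* `JDomain.not_mem_term_of_pathIn_ref` — (**no high bypass**) a site joined to `Tp ∪ J_{>w(α)}`
  by a `𝕋`-path of the domain avoiding `α` is not a site of `c` (because `c ⊆ lower α`).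

Everything here is proved; no named facts are introduced.

## References

* P. Nolin, Near-critical percolation in two dimensions, *Electron. J. Probab.* 13 (2008), §4.4,
  proof of Lemma 15 (arXiv 0711.4948: Lemma 14), last paragraph [Nolin2008].
* H. Kesten, *Percolation theory for mathematicians*, Birkhäuser (1982), §2.3, Prop. 2.3
  [KestenPTM1982].

Tree: `JDomain.subset_lower_of_lowestSeq`, `IsCrossing.compare`, `isCrossing_of_lowestSeq`,
`mem_lower_iff_not_mem_above`, `mem_above_of_pathIn'`, `IsCrossing.mem_above_of_mem_Tp`,
`IsCrossing.mem_above_of_mem_Jabove` (`TriLowestCrossing*.lean`).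
-/

noncomputable section

open Set

namespace Literature.Probability.Percolation

open LatticeModels

namespace JDomain

variable {Q : JDomain} {ω : Set (Site 2)}

/-- **No low bypass.** Let `c = lowestSeq ω u` (tip `z`), let `K` be an open crossing with tip
`z_K`, lying above the term `u - 1` (no condition for `u = 0`), and let `a` be an open crossing
disjoint from `K` whose tip is higher than `z_K`. Then `a` does not meet `c`: `c ⊆ lower K`
(`subset_lower_of_lowestSeq`) while `a ⊆ above K` (comparability). [cite: Nolin2008, §4.4 (arXiv 0711.4948: proof of Lemma 14, last paragraph)] [cite: KestenPTM1982, §2.3 Prop. 2.3] -/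
theorem disjoint_of_stage_crossing (hcut : Q.CutProp) (hdual : Q.DualProp) {u : ℕ}
    {c K a : Finset (Site 2)} {z zK w : Site 2}
    (hu : Q.lowestSeq ω u = some (c, z)) (hK : Q.IsCrossing K zK) (hKω : (↑K : Set (Site 2)) ⊆ ω)
    (hKabove : ∀ v c' z', v + 1 = u → Q.lowestSeq ω v = some (c', z') → K ⊆ Q.above c' z')
    (ha : Q.IsCrossing a w) (hKa : Disjoint K a) (hlt : Q.ht zK < Q.ht w) : Disjoint a c := by
  obtain ⟨-, hL⟩ := subset_lower_of_lowestSeq hcut hdual hu hK hKω hKabove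
  have haK : a ⊆ Q.above K zK := (hK.compare hcut ha hKa hlt).1
  have hc := (isCrossing_of_lowestSeq hu).1
  refine Finset.disjoint_left.2 fun x hxa hxc => ?_
  exact (mem_lower_iff_not_mem_above (hc.subset hxc)).1 (hL hxc) (haK hxa)

/-- **The term lies on or below every open crossing of its stage** (restated from
`subset_lower_of_lowestSeq` for convenience): `c_u ⊆ lower a`. [cite: KestenPTM1982, §2.3 Prop. 2.3] -/
theorem term_subset_lower (hcut : Q.CutProp) (hdual : Q.DualProp) {u : ℕ}
    {c a : Finset (Site 2)} {z w : Site 2}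
    (hu : Q.lowestSeq ω u = some (c, z)) (ha : Q.IsCrossing a w) (haω : (↑a : Set (Site 2)) ⊆ ω)
    (habove : ∀ v c' z', v + 1 = u → Q.lowestSeq ω v = some (c', z') → a ⊆ Q.above c' z') :
    c ⊆ Q.lower a w :=
  (subset_lower_of_lowestSeq hcut hdual hu ha haω habove).2

/-- **No high bypass.** Let `c = lowestSeq ω u` and let `a` (tip `w`) be an open crossing lying
above the term `u - 1`. A site `x` joined to a site `r ∈ Tp ∪ J_{>w}` by a `𝕋`-path of `D ∖ a`
lies in `above a`, hence is not a site of `c ⊆ lower a`. [cite: Nolin2008, §4.4 (arXiv 0711.4948: proof of Lemma 14, last paragraph)] [cite: KestenPTM1982, §2.3 Prop. 2.3] -/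
theorem not_mem_term_of_pathIn_ref (hcut : Q.CutProp) (hdual : Q.DualProp) {u : ℕ}
    {c a : Finset (Site 2)} {z w : Site 2}
    (hu : Q.lowestSeq ω u = some (c, z)) (ha : Q.IsCrossing a w) (haω : (↑a : Set (Site 2)) ⊆ ω)
    (habove : ∀ v c' z', v + 1 = u → Q.lowestSeq ω v = some (c', z') → a ⊆ Q.above c' z')
    {x r : Site 2} (hr : r ∈ Q.Tp ∪ Q.Jabove w)
    (hpath : PathIn triGraph (↑(Q.D \ a) : Set (Site 2)) x r) : x ∉ c := by
  intro hxc
  have hL := term_subset_lower hcut hdual hu ha haω habove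
  have hc := (isCrossing_of_lowestSeq hu).1
  have hra : r ∉ a := (Finset.mem_sdiff.1 (Finset.mem_coe.1 hpath.right_mem)).2
  have hrabove : r ∈ Q.above a w := by
    rcases Finset.mem_union.1 hr with h | h
    · exact ha.mem_above_of_mem_Tp h hra
    · exact ha.mem_above_of_mem_Jabove h
  have hxabove : x ∈ Q.above a w := mem_above_of_pathIn' hrabove hpath.symm
  exact (mem_lower_iff_not_mem_above (hc.subset hxc)).1 (hL hxc) hxabove

/-- **No high bypass, set form**: a connected set of `D ∖ a` containing a site of `Tp ∪ J_{>w}`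
does not meet `c`. [cite: Nolin2008, §4.4 (arXiv 0711.4948: proof of Lemma 14, last paragraph)] -/
theorem disjoint_term_of_conn_ref (hcut : Q.CutProp) (hdual : Q.DualProp) {u : ℕ}
    {c a : Finset (Site 2)} {z w : Site 2}
    (hu : Q.lowestSeq ω u = some (c, z)) (ha : Q.IsCrossing a w) (haω : (↑a : Set (Site 2)) ⊆ ω)
    (habove : ∀ v c' z', v + 1 = u → Q.lowestSeq ω v = some (c', z') → a ⊆ Q.above c' z')
    {K : Set (Site 2)} (hKD : K ⊆ ↑(Q.D \ a)) (hKconn : ∀ x ∈ K, ∀ y ∈ K, PathIn triGraph K x y)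
    {r : Site 2} (hrK : r ∈ K) (hr : r ∈ Q.Tp ∪ Q.Jabove w) : Disjoint K ↑c := by
  refine Set.disjoint_left.2 fun x hxK hxc => ?_
  exact not_mem_term_of_pathIn_ref hcut hdual hu ha haω habove hr ((hKconn x hxK r hrK).mono hKD)
    (Finset.mem_coe.1 hxc)

end JDomain

end Literature.Probability.Percolation
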